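import Summits.ResolutionOfSingularities.ResolutionOfSingularities.Theorems.MarkedTransferCampaignW46MohWindowShadePSModel
import Summits.ResolutionOfSingularities.ResolutionOfSingularities.Theorems.MarkedTransferCampaignW46MohWindowShadeAdapted
import Summits.ResolutionOfSingularities.ResolutionOfSingularities.Theorems.MarkedTransferCampaignW46MohWindowShadeExit
import HarnessLib

/-!
# [OURS · L1 W4.6] Rung (iii) "Moh window", power-series residuals: the ONE-STEP LAWS transferred
  (no-increase, bottom-edge exit, adapted states, Hasse test, origin runs, shadow walks; proofs only)

Cell `res-hironaka`, rung L, slot W4.6, seat `res-L1-s46-pv-6` (gen 6).  `--supports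
stmt-ResolutionOfSingularities-16155 --as helper`.  The per-step theorems of the polynomial shade model
(`…MohWindowShade` gen 0, `…Exit`, `…Adapted`, `…Terminal`) hold VERBATIM for series states
(`…MohWindowShadePSModel`): each is read on a deep truncation through the agreement calculus
(`agree_trunc`, `Agree.step`, `Agree.ordZero_eq`, …).  Plus the SHADOW WALK of a series walk (the polynomial
walk of a truncation of the start along the same charts and points, `shadow`), which agrees with the series
walk below a degree decreasing by `q` per step (`agree_shadow`) — the tool for the finite-horizon transfers
(terminal case here; run formula in `…PSDigits`).  OURS; NOT a statement of the manuscript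
[claim: Hironaka2017, status: under-review], nothing of which is used.  AI review is weaker than expert review.
-/

noncomputable section

set_option linter.dupNamespace false -- mandated namespace of this single-conjunct summit

open MvPolynomial Finset

namespace Summit.ResolutionOfSingularities.ResolutionOfSingularities.Theorems.CampaignW46.MohWindowShadePS

open Literature.AlgebraicGeometry.Resolution
open Literature.AlgebraicGeometry.Resolution.PointBlowup
open Literature.AlgebraicGeometry.Resolution.Hauser2010
open Literature.Barriers.ResolutionOfSingularities (ordZero_le_of_coeff_ne_zero le_ordZero_of_forall)
open MohWindowShadeCleaning (eq_single_add_single degree_eq_add)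

variable {σ : Type*} {K : Type*} [Field K]

/-! ## §1 Small tools on series states -/

/-- The order of a series state is at least `|r|` when `y^r ∣ F`. [folklore] -/
theorem Series.degree_r_le (S : Series σ K) {o : ℕ} (ho : S.F.order = o) (hdiv : Divides S.r S.F) :
    S.r.degree ≤ o := by
  obtain ⟨⟨d₀, hd₀, hd₀deg⟩, -⟩ := MvPowerSeries.order_eq_nat.mp ho
  exact hd₀deg ▸ Finsupp.degree_mono (hdiv d₀ hd₀)

/-- The natural-number order of a series state: all monomials have degree `≥ o`. [folklore] -/
theorem Series.le_degree_of_order_eq (S : Series σ K) {o : ℕ} (ho : S.F.order = o) :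
    ∀ d : σ →₀ ℕ, MvPowerSeries.coeff d S.F ≠ 0 → o ≤ d.degree := by
  intro d hd
  by_contra h
  exact hd (MvPowerSeries.coeff_of_lt_order (by rw [ho]; exact_mod_cast not_le.mp h))

/-- A series state of order `< m` has a natural-number order `< m`. [folklore] -/
theorem Series.exists_order_eq_of_lt (S : Series σ K) {m : ℕ} (h : S.F.order < (m : ℕ∞)) :
    ∃ o : ℕ, S.F.order = o ∧ o < m := by
  have hne : S.F.order ≠ ⊤ := ne_top_of_lt h
  refine ⟨S.F.order.toNat, (ENat.coe_toNat hne).symm, ?_⟩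
  rw [← ENat.coe_toNat hne] at h
  exact_mod_cast h

section TwoLetters

variable [Fintype σ] [DecidableEq σ] [DecidableEq K] {j i : σ}

/-- Two letters: the total new multiplicity after a series step in the chart `y_j` at `b` (`b_j = 0`):
`|r'| = (o − q) + (r_i if b_i = 0, else 0)`. [folklore] -/
theorem Series.degree_step_r (q : ℕ) (hij : i ≠ j) (htwo : ∀ l, l = j ∨ l = i) (b : σ → K)
    (hbj : b j = 0) (S : Series σ K) {o : ℕ} (ho : S.F.order = o) :
    (S.step q j b).r.degree = (o - q) + (if b i = 0 then S.r i else 0) := by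
  rw [degree_eq_add hij htwo, S.step_r_apply hbj ho j, S.step_r_apply hbj ho i, if_pos hbj, if_pos rfl,
    if_neg hij]

end TwoLetters

/-! ## §2 Shadow walks -/

section Shadow

variable [Fintype σ] [DecidableEq σ] [DecidableEq K] (q : ℕ)

/-- The **shadow walk** of depth `M` of a series walk along the charts `c n` and points `b n`: the POLYNOMIAL
walk of the truncation below `M` of the starting series along the same charts and points. [folklore] -/
def shadow (S₀ : Series σ K) (M : ℕ) (c : ℕ → σ) (b : ℕ → σ → K) : ℕ → State σ K
  | 0 => S₀.trunc M
  | n + 1 => PointBlowup.step q (c n) (b n) (shadow S₀ M c b n)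

/-- The shadow walk is a polynomial walk. [folklore] -/
theorem shadow_succ (S₀ : Series σ K) (M : ℕ) (c : ℕ → σ) (b : ℕ → σ → K) (n : ℕ) :
    shadow q S₀ M c b (n + 1) = PointBlowup.step q (c n) (b n) (shadow q S₀ M c b n) := rfl

/-- The shadow walk starts at the truncation. [folklore] -/
theorem shadow_zero (S₀ : Series σ K) (M : ℕ) (c : ℕ → σ) (b : ℕ → σ → K) :
    shadow q S₀ M c b 0 = S₀.trunc M := rfl

/-- **[OURS · L1 W4.6] THE SHADOW WALK AGREES WITH THE SERIES WALK below degree `M − n·q` at stage `n`**,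
as long as the orders of the series states stay below that degree (Hauser–Wagner frame `b n (c n) = 0`).
NOT a statement of the manuscript. [folklore] -/
theorem agree_shadow (S : ℕ → Series σ K) (c : ℕ → σ) (b : ℕ → σ → K) (hb : ∀ n, b n (c n) = 0)
    (hstep : ∀ n, S (n + 1) = (S n).step q (c n) (b n)) (M : ℕ) (n : ℕ)
    (hord : ∀ m, m < n → ∃ o : ℕ, (S m).F.order = o ∧ o < M - m * q) :
    Agree (M - n * q) (shadow q (S 0) M c b n) (S n) := by
  induction n with
  | zero => rw [Nat.zero_mul, Nat.sub_zero]; exact agree_trunc M (S 0)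
  | succ n ih =>
    obtain ⟨o, ho, hoM⟩ := hord n (Nat.lt_succ_self n)
    have h := (ih fun m hm => hord m (by omega)).step q (c n) (b n) (hb n) ho hoM
    rw [shadow_succ, hstep n, show M - (n + 1) * q = M - n * q - q by rw [Nat.succ_mul, Nat.sub_sub]]
    exact h

end Shadow

variable [Fintype σ] [DecidableEq σ] [DecidableEq K]
variable (p : ℕ) [hp : Fact p.Prime] [CharP K p]

/-! ## §3 The no-increase law and the bottom edge for series -/

/-- **[OURS · L1 W4.6] NO SHADE INCREASE INSIDE THE WINDOW, power-series residuals (all dimensions).**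
At an equimultiple point `b` (`b_j = 0`) of the chart `y_j` of a cleaned series state with `y^r ∣ F` and
`p ≤ ord F < 2p`, the shade does not increase: `shade' ≤ shade` (gen 0's
`MohWindowShade.shade_step_le_of_lt_two_mul` read on a truncation; the successor's order `o' < 2p` is a
hypothesis — along in-window walks it holds).  NOT a statement of the manuscript. [folklore] -/
theorem Series.shade_step_le (j : σ) (b : σ → K) (hbj : b j = 0) (S : Series σ K)
    (hclean : IsClean p S.F) {o : ℕ} (ho : S.F.order = o) (hpo : p ≤ o) (ho2 : o < 2 * p)
    (hdiv : Divides S.r S.F) (heq : S.IsEquimultiplePoint p j b) {o' : ℕ}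
    (ho' : (S.step p j b).F.order = o') (ho'2 : o' < 2 * p) : (S.step p j b).shade ≤ S.shade := by
  have hA : Agree (3 * p) (S.trunc (3 * p)) S := agree_trunc _ S
  have hA' : Agree (3 * p - p) _ _ := hA.step p j b hbj ho (by omega)
  rw [← hA'.shade_eq ho' (by omega), ← hA.shade_eq ho (by omega)]
  exact MohWindowShade.shade_step_le_of_lt_two_mul p j b hbj (S.trunc (3 * p))
    (hclean.deletePthPowers_truncTot _) (hA.ordZero_eq ho (by omega)) hpo ho2 (hdiv.truncTot _)
    ((hA.isEquimultiplePoint_iff p j b hbj (by omega)).mpr heq)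

section TwoLetters

variable {j i : σ}

/-- **[OURS · L1 W4.6] SURFACES, series residuals: the bottom edge is an exit.**  A cleaned series state of
order exactly `p` (two letters) has no equimultiple point in the chart `y_j`
(`…Exit.not_isEquimultiplePoint_of_two_vars` read on a truncation).  NOT a statement of the manuscript.
[folklore] -/
theorem Series.not_isEquimultiplePoint_of_order_eq (hij : i ≠ j) (htwo : ∀ k, k = j ∨ k = i)
    (b : σ → K) (hbj : b j = 0) (S : Series σ K) (hclean : IsClean p S.F) (hord : S.F.order = p) :
    ¬ S.IsEquimultiplePoint p j b := by
  have hA : Agree (2 * p) (S.trunc (2 * p)) S := agree_trunc _ S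
  have hp1 : p < 2 * p := by have := hp.out.pos; omega
  rw [← hA.isEquimultiplePoint_iff p j b hbj le_rfl]
  exact MohWindowShadeExit.not_isEquimultiplePoint_of_two_vars p hij htwo b hbj _
    (hclean.deletePthPowers_truncTot _) (hA.ordZero_eq hord hp1)

/-! ## §4 Adapted states for series (surfaces) -/

omit hp [CharP K p] in
/-- **[OURS · L1 W4.6] A stall at the ORIGIN of the chart `y_j` makes the next series state adapted to
`y_j`** (`…Adapted.exists_adapted_of_stall_origin` for series): inside the window, if the shade does not drop
at the origin, the new residual series contains the monomial `y^{r'} · y_i^{o − |r|}`.  NOT a statement of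
the manuscript. [folklore] -/
theorem Series.exists_adapted_of_stall_origin (hij : i ≠ j) (htwo : ∀ l, l = j ∨ l = i) (b : σ → K)
    (hb0 : ∀ l, b l = 0) (S : Series σ K) (hclean : IsClean p S.F) {o : ℕ} (ho : S.F.order = o)
    (hlo : p < o) (hhi : o < 2 * p) (hdiv : Divides S.r S.F) (hstall : ¬ S.ShadeDrops p j b)
    {o' : ℕ} (ho' : (S.step p j b).F.order = o') (ho'2 : o' < 2 * p) :
    ∃ E : σ →₀ ℕ, MvPowerSeries.coeff E (S.step p j b).F ≠ 0 ∧
      E j = (S.step p j b).r j ∧ E i = (S.step p j b).r i + (o - S.r.degree) := by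
  have hA : Agree (5 * p) (S.trunc (5 * p)) S := agree_trunc _ S
  have hA' : Agree (5 * p - p) _ _ := hA.step p j b (hb0 j) ho (by omega)
  have hstall' : ¬ PointBlowup.ShadeDrops p j b (S.trunc (5 * p)) := by
    unfold PointBlowup.ShadeDrops
    rw [hA'.shade_eq ho' (by omega), hA.shade_eq ho (by omega)]
    exact hstall
  obtain ⟨E, hE, hEj, hEi⟩ := MohWindowShadeAdapted.exists_adapted_of_stall_origin p hij htwo b hb0
    (S.trunc (5 * p)) (hclean.deletePthPowers_truncTot _) (hA.ordZero_eq ho (by omega)) hlo hhi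
    (hdiv.truncTot _) hstall'
  have hr' : (PointBlowup.step p j b (S.trunc (5 * p))).r = (S.step p j b).r := hA'.2
  rw [hr'] at hEj hEi
  have hrS : (S.trunc (5 * p)).r = S.r := rfl
  rw [hrS] at hEi
  have hrle : S.r.degree ≤ o := S.degree_r_le ho hdiv
  have hrj : (S.step p j b).r j = o - p := by
    rw [S.step_r_apply (hb0 j) ho j, if_pos (hb0 j), if_pos rfl]
  have hri : (S.step p j b).r i = S.r i := by
    rw [S.step_r_apply (hb0 j) ho i, if_pos (hb0 i), if_neg hij]
  have hriS : S.r i ≤ S.r.degree := Finsupp.le_degree i S.r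
  have hEdeg : E.degree < 5 * p - p := by
    rw [degree_eq_add hij htwo E, hEj, hEi, hrj, hri]
    omega
  exact ⟨E, (hA'.mem_support_iff hEdeg).mp hE, hEj, hEi⟩

omit [DecidableEq σ] hp [CharP K p] in
/-- **[OURS · L1 W4.6] From a series state adapted to `y_j`, the vertical move drops the shade**
(`…Adapted.shadeDrops_vertical_of_adapted` for series).  NOT a statement of the manuscript. [folklore] -/
theorem Series.shadeDrops_vertical_of_adapted [DecidableEq σ] (S : Series σ K) {o : ℕ}
    (ho : S.F.order = o) (hlo : p < o) (hhi : o < 2 * p) (hdiv : Divides S.r S.F) {E : σ →₀ ℕ}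
    (hE : MvPowerSeries.coeff E S.F ≠ 0) (hEdeg : E.degree = o) (hEi : S.r i < E i) {o' : ℕ}
    (ho' : (S.step p i 0).F.order = o') (ho'2 : o' < 2 * p) : S.ShadeDrops p i 0 := by
  have hA : Agree (3 * p) (S.trunc (3 * p)) S := agree_trunc _ S
  have hA' : Agree (3 * p - p) _ _ := hA.step p i (0 : σ → K) rfl ho (by omega)
  have hEs : E ∈ (S.trunc (3 * p)).F.support := (hA.mem_support_iff (by omega)).mpr hE
  have hEi' : (S.trunc (3 * p)).r i < E i := hEi
  have h := MohWindowShadeAdapted.shadeDrops_vertical_of_adapted p (i := i) (S.trunc (3 * p))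
    (hA.ordZero_eq ho (by omega)) hlo hhi (hdiv.truncTot _) hEs hEdeg hEi'
  unfold PointBlowup.ShadeDrops at h
  unfold Series.ShadeDrops
  rwa [hA'.shade_eq ho' (by omega), hA.shade_eq ho (by omega)] at h

omit hp [CharP K p] in
/-- **[OURS · L1 W4.6] A stall at a TRANSLATED point makes the next series state adapted (and loses `r_i`)**
(`…Adapted.mem_support_step_of_stall_translate` for series, gen 2's Hasse test): the new residual series
contains `y_j^{o−p} · y_i^{o − |r|}`.  NOT a statement of the manuscript. [folklore] -/
theorem Series.coeff_step_ne_zero_of_stall_translate (hij : i ≠ j) (htwo : ∀ l, l = j ∨ l = i)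
    (b : σ → K) (hbj : b j = 0) (hbi : b i ≠ 0) (S : Series σ K) {o : ℕ} (ho : S.F.order = o)
    (hlo : p < o) (hhi : o < 2 * p) (hdiv : Divides S.r S.F) (hstall : ¬ S.ShadeDrops p j b)
    {o' : ℕ} (ho' : (S.step p j b).F.order = o') (ho'2 : o' < 2 * p) :
    MvPowerSeries.coeff (Finsupp.single j (o - p) + Finsupp.single i (o - S.r.degree)) (S.step p j b).F
      ≠ 0 := by
  have hA : Agree (4 * p) (S.trunc (4 * p)) S := agree_trunc _ S
  have hA' : Agree (4 * p - p) _ _ := hA.step p j b hbj ho (by omega)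
  have hstall' : ¬ PointBlowup.ShadeDrops p j b (S.trunc (4 * p)) := by
    unfold PointBlowup.ShadeDrops
    rw [hA'.shade_eq ho' (by omega), hA.shade_eq ho (by omega)]
    exact hstall
  have h := MohWindowShadeAdapted.mem_support_step_of_stall_translate p hij htwo b hbj hbi
    (S.trunc (4 * p)) (hA.ordZero_eq ho (by omega)) hlo hhi (hdiv.truncTot _) hstall'
  have hrS : (S.trunc (4 * p)).r = S.r := rfl
  rw [hrS] at h
  refine (hA'.mem_support_iff ?_).mp h
  rw [map_add, Finsupp.degree_single, Finsupp.degree_single]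
  omega

end TwoLetters

/-! ## §5 Origin runs of series states (all dimensions) -/

omit hp [CharP K p] in
/-- At the origin of a chart a monomial of a cleaned series state of order `≥ p` survives with its
coefficient (`…Adapted.coeff_chartExponent_step_origin` for series). [folklore] -/
theorem Series.coeff_chartExponent_step_origin (c : σ) (S : Series σ K) (hclean : IsClean p S.F)
    {o : ℕ} (ho : S.F.order = o) (hpo : p ≤ o) {d : σ →₀ ℕ} (hd : MvPowerSeries.coeff d S.F ≠ 0) :
    MvPowerSeries.coeff (chartExponent p c d) (S.step p c 0).F = MvPowerSeries.coeff d S.F := by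
  have hA : Agree (d.degree + p + 1) (S.trunc (d.degree + p + 1)) S := agree_trunc _ S
  have hdeg : ∀ d' ∈ (S.trunc (d.degree + p + 1)).F.support, p ≤ d'.degree := fun d' hd' =>
    le_trans hpo (S.le_degree_of_order_eq ho d' ((hA.mem_support_iff
      (degree_lt_of_mem_support_truncTot hd')).mp hd'))
  have hdN : d.degree < d.degree + p + 1 := by omega
  have h1 : MvPowerSeries.coeff (chartExponent p c d) (S.step p c 0).F =
      coeff (chartExponent p c d) (PointBlowup.step p c 0 (S.trunc (d.degree + p + 1))).F := by
    refine Series.coeff_step_F (q := p) (j := c) (b := (0 : σ → K)) rfl S (chartExponent p c d)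
      (s := S.trunc (d.degree + p + 1)) fun d' hd' => hA.1 d' ?_
    rw [chartExponent_apply, if_pos rfl] at hd'
    omega
  rw [h1, MohWindowShadeAdapted.coeff_chartExponent_step_origin p c (S.trunc (d.degree + p + 1))
    (hclean.deletePthPowers_truncTot _) hdeg ((hA.mem_support_iff hdN).mpr hd), hA.1 d hdN]

omit hp [CharP K p] in
/-- **[OURS · L1 W4.6] AN INFINITE ORIGIN RUN IN ONE CHART FORCES A COORDINATE `p`-TH POWER, series
residuals (all dimensions)** (`…Adapted.forall_le_sum_of_origin_run` for series): along
`S_{n+1} = step p c 0 (S n)` from a cleaned series state, all residual series of order `≥ p` (a natural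
number), every monomial `y^d` of `F₀` has `Σ_{l ≠ c} d_l ≥ p`.  NOT a statement of the manuscript. [folklore] -/
theorem Series.forall_le_sum_of_origin_run (c : σ) (S : ℕ → Series σ K)
    (hstep : ∀ n, S (n + 1) = (S n).step p c 0) (hclean : IsClean p (S 0).F)
    (hord : ∀ n, ∃ o : ℕ, (S n).F.order = o ∧ p ≤ o) :
    ∀ d : σ →₀ ℕ, MvPowerSeries.coeff d (S 0).F ≠ 0 → p ≤ ∑ l ∈ univ.erase c, d l := by
  classical
  have hcl : ∀ n, IsClean p (S n).F := by
    intro n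
    rcases n with _ | n
    · exact hclean
    · rw [hstep n]; exact (S n).isClean_step p c 0
  intro d hd
  by_contra hlt
  push Not at hlt
  have hmem : ∀ n, MvPowerSeries.coeff ((chartExponent p c)^[n] d) (S n).F ≠ 0 ∧
      ((chartExponent p c)^[n] d).degree + n ≤ d.degree ∧
      ∑ l ∈ univ.erase c, ((chartExponent p c)^[n] d) l = ∑ l ∈ univ.erase c, d l := by
    intro n
    induction n with
    | zero => exact ⟨hd, by simp, rfl⟩
    | succ n ih =>
      obtain ⟨ih1, ih2, ih3⟩ := ih
      obtain ⟨o, ho, hpo⟩ := hord n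
      rw [Function.iterate_succ_apply', hstep n]
      refine ⟨?_, ?_, ?_⟩
      · rw [(S n).coeff_chartExponent_step_origin p c (hcl n) ho hpo ih1]
        exact ih1
      · have h1 := degree_chartExponent p c ((chartExponent p c)^[n] d)
        have h2 := degree_eq_add_sum_erase c ((chartExponent p c)^[n] d)
        have h3 := (S n).le_degree_of_order_eq ho _ ih1
        rw [ih3] at h2
        omega
      · rw [← ih3]
        exact Finset.sum_congr rfl fun l hl => by
          rw [chartExponent_apply, if_neg (Finset.ne_of_mem_erase hl)]
  obtain ⟨-, h, -⟩ := hmem (d.degree + 1)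
  omega

/-! ## §6 The terminal case for series (finite horizon, all dimensions) -/

/-- **[OURS · L1 W4.6] TERMINATION of the terminal case inside the window when no proper centre exists,
series residuals** (`…Terminal.length_le_of_noProperCentre` on the shadow walk): from a cleaned
coordinate-monomial series state (`y^r ∣ F`, `ord F = |r|`, `p < |r| < 2p`, every proper set of components of
multiplicity `< p`), if the first `N` points of a series walk (all its states of order `< 2p`) are
equimultiple then `N + p ≤ |r₀|`.  NOT a statement of the manuscript. [folklore] -/
theorem Series.length_le_of_noProperCentre (S : ℕ → Series σ K) (c : ℕ → σ) (b : ℕ → σ → K)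
    (hb : ∀ n, b n (c n) = 0) (hstep : ∀ n, S (n + 1) = (S n).step p (c n) (b n))
    (hclean : IsClean p (S 0).F) (hdiv : Divides (S 0).r (S 0).F)
    (hord : (S 0).F.order = ((S 0).r.degree : ℕ)) (hlo : p < (S 0).r.degree)
    (hhi : (S 0).r.degree < 2 * p) (hnpc : ∀ k, ∑ l ∈ univ.erase k, (S 0).r l < p) {N : ℕ}
    (hwin : ∀ n, n < N → (S n).F.order < (2 * p : ℕ))
    (heq : ∀ n, n < N → (S n).IsEquimultiplePoint p (c n) (b n)) :
    N + p ≤ (S 0).r.degree := by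
  have hsub : ∀ m, (N + 2) * p - m * p = (N + 2 - m) * p := fun m => (Nat.sub_mul _ _ _).symm
  have hordM : ∀ m, m < N → ∃ o : ℕ, (S m).F.order = o ∧ o < (N + 2) * p - m * p := by
    intro m hm
    obtain ⟨o, ho, ho2⟩ := (S m).exists_order_eq_of_lt (hwin m hm)
    refine ⟨o, ho, ?_⟩
    rw [hsub]
    calc o < 2 * p := ho2
      _ ≤ (N + 2 - m) * p := Nat.mul_le_mul_right p (by omega)
  have hA0 : Agree ((N + 2) * p) (shadow p (S 0) ((N + 2) * p) c b 0) (S 0) := agree_trunc _ (S 0)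
  have hMlo : (S 0).r.degree < (N + 2) * p :=
    calc (S 0).r.degree < 2 * p := hhi
      _ ≤ (N + 2) * p := Nat.mul_le_mul_right p (by omega)
  refine MohWindowShadeTerminal.length_le_of_noProperCentre p (shadow p (S 0) ((N + 2) * p) c b) c b hb
    (shadow_succ p (S 0) ((N + 2) * p) c b) (hclean.deletePthPowers_truncTot _) (hdiv.truncTot _)
    (hA0.ordZero_eq hord hMlo) hlo hhi hnpc (N := N) fun n hn => ?_
  have hA := agree_shadow p S c b hb hstep ((N + 2) * p) n fun m hm => hordM m (by omega)
  have h2p : 2 * p ≤ (N + 2) * p - n * p := by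
    rw [hsub]; exact Nat.mul_le_mul_right p (by omega)
  exact (hA.isEquimultiplePoint_iff p (c n) (b n) (hb n) h2p).mpr (heq n hn)

end Summit.ResolutionOfSingularities.ResolutionOfSingularities.Theorems.CampaignW46.MohWindowShadePS
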